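import Literature.NumberTheory.EllipticCurves.SigmaSqNormThroughInvXProofs
import Literature.NumberTheory.EllipticCurves.CanonicalPAdicHeightRestrictionProofs
import Mathlib.RingTheory.Norm.Transitivity
import Mathlib.RingTheory.Trace.Basic
import Mathlib.Algebra.Polynomial.SpecificDegree
import HarnessLib

/-!
# `sigmaSqNormLog` at a point with rational `x`-coordinate: `Σ_{w∣p} log_p N_{H_w/ℚ_p} Σ_p(z) =
# [H:ℚ] · log_p 𝔖_p(1/x)` (proofs only)

Topic `Literature/NumberTheory/EllipticCurves` (trunk T-NT-EC); PROOFS file (theorems only: no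
definition, no named fact, no instance). Sequel of `SigmaSqNormThroughInvXProofs.lean` (the
`ℚ_p`-identity `2 log_p e + Σ' ℒ_n t_n = 2 log_p 𝔖(w)` for Newton sequences) and
`CanonicalPAdicHeightCyc.lean` (`sigmaSqNormLog W p H z = 2 log_p N_{H/ℚ}(z) + Σ' ℒ_n Tr_{H/ℚ}(zⁿ)`,
the `p`-part of the cyclotomic `p`-adic height over the number field `H`). Width seat
`bsd-line-cf2-p1-w8` (g26), BSD cell `bsd-print-cf2`, towards the route-A aside
stmt-BirchSwinnertonDyer-27316 (`isCanonicalCyc_pairing_eq_minusTwist`).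

## Result (`sigmaSqNormLog_eq_of_ratCast`)

For `V/ℚ` with `V ⊗ ℚ_p` `ℤ_p`-integral carrying a sigma-squared pair, a number field `H`, and a point
`(x, y) ∈ V(H)` with RATIONAL `x = x′`, `‖x′‖_p > 1`, and `y ∉ ℚ` (so `F′ = ℚ(z)`, `z = −x/y`, is a
quadratic field):

  `sigmaSqNormLog V p H (−x/y) = [H:ℚ] · log_p 𝔖_p((x′)⁻¹)`   (`𝔖_p = padicSigmaSqInvX V p`).

TOWER ARGUMENT: `N_{H/ℚ}(z) = N_{F′/ℚ}(z)^{[H:F′]}`, `Tr_{H/ℚ}(zⁿ) = [H:F′]·Tr_{F′/ℚ}(zⁿ)`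
(`Algebra.norm_eq_norm_adjoin`, `Algebra.trace_trace`); in `F′` the minimal polynomial of `z` is
`T² − sT + e` with the RATIONAL `e = −x′²/g(x′) = −w/D(w)`, `s = −x′(a₁x′ + a₃)/g(x′) = −(a₁w + a₃w²)/D(w)`
(`w = 1/x′`, `g = x³ + a₂x² + a₄x + a₆ = −yȳ`, `ȳ = −y − a₁x − a₃`), so `N_{F′/ℚ}(z) = e`,
`Tr_{F′/ℚ}(z) = s` and `t_n = Tr_{F′/ℚ}(zⁿ)` is the Newton sequence of `(s, e)`; then
`two_mul_padicLog_add_tsum_eq` gives `2 log_p e + Σ' ℒ_n t_n = 2 log_p 𝔖_p(w)` and the factor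
`[H:F′]·2 = [H:ℚ]` assembles the claim. Pure `ℚ_p`; no completion of `H` is formed.

## References

* B. Mazur, W. Stein, J. Tate, Doc. Math. Extra Vol. Coates (2006), §2.8 (`ρ^K_cycl = ρ^ℚ_cycl ∘ N_{K/ℚ}`,
  `h_p(P) = p⁻¹[Σ_{v∣p} log_p N_{K_v/ℚ_p} σ_v(P) − …]`). [MazurSteinTate2006]
* D. Disegni, Compos. Math. 153 (2017), §4.1.1 (4.1.7)–(4.1.8) (compatibility with restriction).
  [Disegni2017]
* J. H. Silverman, Math. Ann. 332 (2005), §5 Rem. 2. [Silverman2005DivPoly]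
-/

noncomputable section

open scoped Classical
open Polynomial IntermediateField Module Literature.NumberTheory.EllipticCurves

namespace WeierstrassCurve

variable {p : ℕ} [Fact p.Prime] (V : WeierstrassCurve ℚ) [(V.baseChange ℚ_[p]).IsIntegral ℤ_[p]]
  (H : Type) [Field H] [NumberField H]

/-- **The two conjugates above a rational `x`.** For `(x′, y) ∈ V(H)` with `x′ ∈ ℚ`, `y ∉ ℚ`:
`z = −x′/y` is a root of the RATIONAL quadratic `T² − sT + e`,
`s = −x′(a₁x′ + a₃)/g(x′)`, `e = −x′²/g(x′)`, `g(x′) = x′³ + a₂x′² + a₄x′ + a₆ = −y(−y − a₁x′ − a₃) ≠ 0`,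
which has no rational root; hence it is `minpoly ℚ z` and `[ℚ(z):ℚ] = 2`.
[cite: SilvermanAEC2009, III.2.3] [cite: MazurSteinTate2006, §2.8] -/
theorem minpoly_neg_div_eq_of_ratCast {x' : ℚ} {y : H} (heq : (V.baseChange H).toAffine.Equation (x' : H) y)
    (hy : y ∉ Set.range (algebraMap ℚ H)) (hx0 : x' ≠ 0) :
    x' ^ 3 + V.a₂ * x' ^ 2 + V.a₄ * x' + V.a₆ ≠ 0 ∧ minpoly ℚ (-(x' : H) / y) =
      C 1 * X ^ 2 + C (x' * (V.a₁ * x' + V.a₃) / (x' ^ 3 + V.a₂ * x' ^ 2 + V.a₄ * x' + V.a₆)) * X +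
        C (-x' ^ 2 / (x' ^ 3 + V.a₂ * x' ^ 2 + V.a₄ * x' + V.a₆)) := by
  set g : ℚ := x' ^ 3 + V.a₂ * x' ^ 2 + V.a₄ * x' + V.a₆ with hg
  have hA1 : (V.baseChange H).a₁ = (V.a₁ : H) := by simp only [baseChange, map_a₁, eq_ratCast]
  have hA2 : (V.baseChange H).a₂ = (V.a₂ : H) := by simp only [baseChange, map_a₂, eq_ratCast]
  have hA3 : (V.baseChange H).a₃ = (V.a₃ : H) := by simp only [baseChange, map_a₃, eq_ratCast]
  have hA4 : (V.baseChange H).a₄ = (V.a₄ : H) := by simp only [baseChange, map_a₄, eq_ratCast]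
  have hA6 : (V.baseChange H).a₆ = (V.a₆ : H) := by simp only [baseChange, map_a₆, eq_ratCast]
  have heq' := heq
  rw [Affine.equation_iff, hA1, hA2, hA3, hA4, hA6] at heq'
  -- `y ≠ 0`, `ȳ ≠ 0`, `g ≠ 0`
  have hy0 : y ≠ 0 := fun h => hy ⟨0, by rw [h, map_zero]⟩
  set yb : H := -y - (V.a₁ : H) * x' - (V.a₃ : H) with hyb
  have hyb0 : yb ≠ 0 := fun h => hy ⟨-(V.a₁ * x' + V.a₃), by
    rw [eq_ratCast]; push_cast; linear_combination h⟩
  have hgH : (g : H) = -(y * yb) := by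
    rw [hg]; push_cast; rw [hyb]; linear_combination -heq'
  have hg0 : g ≠ 0 := by
    intro h
    rw [h, Rat.cast_zero, eq_comm, neg_eq_zero, mul_eq_zero] at hgH
    exact hgH.elim hy0 hyb0
  refine ⟨hg0, ?_⟩
  set z : H := -(x' : H) / y with hz
  set zb : H := -(x' : H) / yb with hzb
  set s : ℚ := x' * (V.a₁ * x' + V.a₃) / g with hs
  set e : ℚ := -x' ^ 2 / g with he
  have hgH0 : (g : H) ≠ 0 := by exact_mod_cast hg0
  -- Vieta in `H`
  have hsum : z + zb = -(s : H) := by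
    rw [hz, hzb, hs]; push_cast; rw [hgH]; field_simp; rw [hyb]; ring
  have hprod : z * zb = (e : H) := by
    rw [hz, hzb, he]; push_cast; rw [hgH]; field_simp
  set Q : ℚ[X] := C 1 * X ^ 2 + C s * X + C e with hQ
  have hQmonic : Q.Monic := by
    rw [Monic, hQ, leadingCoeff_quadratic one_ne_zero]
  have hQdeg : Q.natDegree = 2 := by rw [hQ]; exact natDegree_quadratic one_ne_zero
  have hQeval : ∀ r : H, aeval r Q = (r - z) * (r - zb) := fun r => by
    rw [hQ, map_add, map_add, map_mul, map_mul, map_pow, aeval_C, aeval_C, aeval_C, aeval_X,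
      map_one, one_mul, eq_ratCast, eq_ratCast]
    linear_combination r * hsum - hprod
  have hQz : aeval z Q = 0 := by rw [hQeval, sub_self, zero_mul]
  -- no rational root
  have hx0H : (x' : H) ≠ 0 := by exact_mod_cast hx0
  have hQirr : Irreducible Q := by
    rw [hQmonic.irreducible_iff_roots_eq_zero_of_degree_le_three (by omega) (by omega),
      Multiset.eq_zero_iff_forall_notMem]
    intro r hr
    rw [mem_roots hQmonic.ne_zero, IsRoot.def] at hr
    have hr' : aeval (r : H) Q = 0 := by
      rw [show (r : H) = algebraMap ℚ H r from (eq_ratCast _ r).symm, aeval_algebraMap_apply,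
        coe_aeval_eq_eval, hr, map_zero]
    rw [hQeval, mul_eq_zero, sub_eq_zero, sub_eq_zero] at hr'
    rcases hr' with h | h
    · exact hy ⟨-x' / r, by rw [eq_ratCast]; push_cast; rw [h, hz]; field_simp⟩
    · apply hy
      refine ⟨-(-x' / r) - V.a₁ * x' - V.a₃, ?_⟩
      rw [eq_ratCast]; push_cast
      have : (r : H) * yb = -x' := by rw [h, hzb]; field_simp
      have hr0 : (r : H) ≠ 0 := by
        intro h0; rw [h0, zero_mul] at this; exact hx0H (neg_eq_zero.mp this.symm)
      have hyb' : yb = -(x' : H) / r := by field_simp; linear_combination this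
      rw [hyb] at hyb'
      linear_combination hyb'
  exact (minpoly.eq_of_irreducible_of_monic hQirr hQz hQmonic).symm

/-- **`sigmaSqNormLog` at a point with rational `x`-coordinate.** For `V/ℚ` with `V ⊗ ℚ_p`
`ℤ_p`-integral carrying a sigma-squared pair, a number field `H`, `(x′, y) ∈ V(H)` with `x′ ∈ ℚ`,
`‖x′‖_p > 1` and `y ∉ ℚ`:
`sigmaSqNormLog V p H (−x′/y) = [H:ℚ] · log_p 𝔖_p((x′)⁻¹)` — the `p`-part of the cyclotomic height of
the point is the `x`-only sigma value, `[H:ℚ]` times (Mazur–Stein–Tate `ρ^H_cycl = ρ^ℚ_cycl ∘ N_{H/ℚ}`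
through the tower `ℚ ⊂ ℚ(z) ⊂ H` and `two_mul_padicLog_add_tsum_eq`).
[cite: MazurSteinTate2006, §2.8] [cite: Disegni2017, §4.1.1 (4.1.7)–(4.1.8)] [cite: Silverman2005DivPoly, §5 Rem. 2] -/
theorem sigmaSqNormLog_eq_of_ratCast
    (hpair : ∃ Sq : PowerSeries ℚ_[p], ∃ c : ℚ_[p], (V.baseChange ℚ_[p]).IsMazurTateSigmaSqPair Sq c)
    {x' : ℚ} {y : H} (heq : (V.baseChange H).toAffine.Equation (x' : H) y)
    (hy : y ∉ Set.range (algebraMap ℚ H)) (hx : 1 < ‖((x' : ℚ_[p]))‖) :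
    V.sigmaSqNormLog p H (-(x' : H) / y) =
      (Module.finrank ℚ H : ℚ_[p]) * padicLog p (V.padicSigmaSqInvXEval p ((x' : ℚ_[p]))⁻¹) := by
  have hx0 : x' ≠ 0 := by
    intro h; rw [h, Rat.cast_zero, norm_zero] at hx; exact absurd hx (by norm_num)
  obtain ⟨hg0, hmin⟩ := V.minpoly_neg_div_eq_of_ratCast H heq hy hx0
  set g : ℚ := x' ^ 3 + V.a₂ * x' ^ 2 + V.a₄ * x' + V.a₆ with hg
  set s : ℚ := x' * (V.a₁ * x' + V.a₃) / g with hs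
  set e : ℚ := -x' ^ 2 / g with he
  set z : H := -(x' : H) / y with hz
  -- the intermediate field `F′ = ℚ(z)`: `[F′:ℚ] = 2`, `[H:ℚ] = 2m`
  have hint : _root_.IsIntegral ℚ z := Algebra.IsIntegral.isIntegral z
  haveI : FiniteDimensional ℚ ℚ⟮z⟯ := adjoin.finiteDimensional hint
  have hQdeg : (C 1 * X ^ 2 + C s * X + C e : ℚ[X]).natDegree = 2 := natDegree_quadratic one_ne_zero
  have hFdeg : finrank ℚ ℚ⟮z⟯ = 2 := by rw [adjoin.finrank hint, hmin, hQdeg]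
  set m : ℕ := finrank ℚ⟮z⟯ H with hm
  have hdeg : finrank ℚ H = 2 * m := by rw [← finrank_mul_finrank ℚ ℚ⟮z⟯ H, hFdeg]
  have hm0 : (m : ℚ) ≠ 0 := by
    have : 0 < m := finrank_pos
    exact_mod_cast this.ne'
  -- norm and trace of `z` down to `ℚ`
  have hnorm : Algebra.norm ℚ z = e ^ m := by
    have h := Algebra.PowerBasis.norm_gen_eq_coeff_zero_minpoly (adjoin.powerBasis hint)
    simp only [adjoin.powerBasis_gen, adjoin.powerBasis_dim, minpoly_gen, hmin, hQdeg] at h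
    rw [Algebra.norm_eq_norm_adjoin ℚ z, h, ← hm]
    simp
  have htraceZ : Algebra.trace ℚ H z = (m : ℚ) * -s := by
    have h := trace_eq_finrank_mul_minpoly_nextCoeff ℚ z
    rw [hmin, nextCoeff_of_natDegree_pos (by rw [hQdeg]; norm_num), hQdeg] at h
    rw [h, ← hm]
    simp
  -- the relation `z² = -s z - e` in `H` and the Newton sequence of traces
  have hzrel : z ^ 2 + (s : H) * z + (e : H) = 0 := by
    have h := minpoly.aeval ℚ z
    rw [hmin, map_add, map_add, map_mul, map_mul, map_pow, aeval_C, aeval_C, aeval_C, aeval_X, map_one,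
      one_mul, eq_ratCast, eq_ratCast] at h
    exact h
  set T : ℕ → ℚ := fun n => Algebra.trace ℚ H (z ^ n) with hT
  have hTrec : ∀ n, T (n + 2) = -s * T (n + 1) - e * T n := fun n => by
    have hz2 : z ^ (n + 2) = -(s • z ^ (n + 1)) - e • z ^ n := by
      rw [Algebra.smul_def, Algebra.smul_def, eq_ratCast, eq_ratCast, pow_add, pow_succ]
      linear_combination z ^ n * hzrel
    simp only [hT]
    rw [hz2, map_sub, map_neg, map_smul, map_smul, smul_eq_mul, smul_eq_mul]
    ring
  have hT0 : T 0 = 2 * m := by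
    simp only [hT, pow_zero]
    rw [← (algebraMap ℚ H).map_one, Algebra.trace_algebraMap, hdeg]
    simp
  have hT1 : T 1 = (m : ℚ) * -s := by simp only [hT, pow_one]; exact htraceZ
  set t : ℕ → ℚ := fun n => T n / m with ht
  have htT : ∀ n, Algebra.trace ℚ H (z ^ n) = (m : ℚ) * t n := fun n => by
    simp only [ht, hT]; field_simp
  have ht0 : t 0 = 2 := by simp only [ht]; rw [hT0]; field_simp
  have ht1 : t 1 = -s := by simp only [ht]; rw [hT1]; field_simp
  have htrec : ∀ n, t (n + 2) = -s * t (n + 1) - e * t n := fun n => by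
    simp only [ht]; rw [hTrec]; ring
  -- the `ℚ_p` side
  set w : ℚ_[p] := ((x' : ℚ_[p]))⁻¹ with hw
  have hx0p : ((x' : ℚ_[p])) ≠ 0 := by exact_mod_cast hx0
  have hw0 : w ≠ 0 := inv_ne_zero hx0p
  have hwlt : ‖w‖ < 1 := by rw [hw, norm_inv]; exact inv_lt_one_of_one_lt₀ hx
  have hinv := isInvXExpansion_padicSigmaSqInvX_of_exists_pair (V := V) (p := p) (Or.inr hpair)
  have ha : (V.baseChange ℚ_[p]).a₁ = (V.a₁ : ℚ_[p]) ∧ (V.baseChange ℚ_[p]).a₂ = (V.a₂ : ℚ_[p]) ∧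
      (V.baseChange ℚ_[p]).a₃ = (V.a₃ : ℚ_[p]) ∧ (V.baseChange ℚ_[p]).a₄ = (V.a₄ : ℚ_[p]) ∧
      (V.baseChange ℚ_[p]).a₆ = (V.a₆ : ℚ_[p]) := by
    simp only [baseChange, map_a₁, map_a₂, map_a₃, map_a₄, map_a₆, eq_ratCast, and_self]
  obtain ⟨e1, e2, e3, e4, e6⟩ := ha
  set Dv : ℚ_[p] := 1 + (V.baseChange ℚ_[p]).a₂ * w + (V.baseChange ℚ_[p]).a₄ * w ^ 2 +
    (V.baseChange ℚ_[p]).a₆ * w ^ 3 with hDv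
  have hgp : ((g : ℚ) : ℚ_[p]) ≠ 0 := by exact_mod_cast hg0
  have hDvg : Dv = (g : ℚ_[p]) * w ^ 3 := by
    rw [hDv, e2, e4, e6, hg]; push_cast; rw [hw]; field_simp
  have hDv0 : Dv ≠ 0 := by rw [hDvg]; exact mul_ne_zero hgp (pow_ne_zero _ hw0)
  have hecast : ((e : ℚ) : ℚ_[p]) = -w / Dv := by
    rw [hDvg, he]; push_cast; rw [hw]; field_simp
  have hscast : -((s : ℚ) : ℚ_[p]) =
      -((V.baseChange ℚ_[p]).a₁ * w + (V.baseChange ℚ_[p]).a₃ * w ^ 2) / Dv := by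
    rw [hDvg, hs, e1, e3]; push_cast; rw [hw]; field_simp
  -- apply the `ℚ_p` norm identity to `n ↦ (t n : ℚ_p)`
  have key := (V.baseChange ℚ_[p]).two_mul_padicLog_add_tsum_eq hpair hinv hwlt hw0
    (fun n => ((t n : ℚ) : ℚ_[p])) (by simp only [ht0]; norm_num)
    (by simp only [ht1]; push_cast; exact hscast) (fun n => by
      have h1 : (((t (n + 2) : ℚ)) : ℚ_[p]) =
          -((s : ℚ) : ℚ_[p]) * ((t (n + 1) : ℚ) : ℚ_[p]) - ((e : ℚ) : ℚ_[p]) * ((t n : ℚ) : ℚ_[p]) := by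
        rw [htrec n]; push_cast; ring
      show (((t (n + 2) : ℚ)) : ℚ_[p]) = _
      rw [h1, hscast, hecast])
  rw [← hecast] at key
  -- assemble
  have hep : ((e : ℚ) : ℚ_[p]) ≠ 0 := by rw [hecast]; exact div_ne_zero (neg_ne_zero.mpr hw0) hDv0
  rw [sigmaSqNormLog_def, hnorm, eq_ratCast]
  simp_rw [htT, eq_ratCast]
  push_cast
  rw [padicLog_pow p hep]
  have hsum : ∑' n : ℕ, PowerSeries.coeff n (V.baseChange ℚ_[p]).padicLogSigmaSqShift *
        ((m : ℚ_[p]) * (t n : ℚ_[p])) =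
      (m : ℚ_[p]) * ∑' n : ℕ, PowerSeries.coeff n (V.baseChange ℚ_[p]).padicLogSigmaSqShift *
        (t n : ℚ_[p]) := by
    rw [← tsum_mul_left]
    exact tsum_congr fun n => by ring
  rw [hsum, hdeg]
  push_cast
  have hSx : V.padicSigmaSqInvXEval p w = padicEval (V.padicSigmaSqInvX p) w := rfl
  rw [hSx]
  linear_combination (m : ℚ_[p]) * key

end WeierstrassCurve

end
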